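import Summits.BirchSwinnertonDyer.BirchSwinnertonDyer.Theorems.ByReductionTypeAtTwoRankOneAtTwoBigImageOddLocalOneDoorBottomLemma43AtTwo
import Summits.BirchSwinnertonDyer.BirchSwinnertonDyer.Theorems.ByReductionTypeAtTwoRankOneAtTwoBigImageOddLocalOneDoorBottomFirstLayerData
import Summits.BirchSwinnertonDyer.BirchSwinnertonDyer.Theorems.ByReductionTypeAtTwoRankOneAtTwoBigImageOddLocalOneDoorBottomCrossTransport
import Summits.BirchSwinnertonDyer.BirchSwinnertonDyer.Theorems.ByReductionTypeAtTwoRankOneAtTwoBigImageOddLocalOneDoorHalvesJointDoor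
import Summits.BirchSwinnertonDyer.BirchSwinnertonDyer.Theorems.ByReductionTypeAtTwoRankOneAtTwoBigImageOddLocalOneDoorIndexLawOfKolyvaginExact
import Summits.BirchSwinnertonDyer.BirchSwinnertonDyer.Theorems.GenusKolyvaginAtTwoVisiblePairAtTwoInputReductionsHeegner
import Summits.BirchSwinnertonDyer.BirchSwinnertonDyer.Theorems.GenusKolyvaginAtTwoEquivariantKolyvaginExactAtTwoPropFourFourRat
import Summits.BirchSwinnertonDyer.BirchSwinnertonDyer.Theorems.GenusKolyvaginAtTwoEquivariantKolyvaginExactAtTwoArchimedeanSelmerLevel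
import Summits.BirchSwinnertonDyer.BirchSwinnertonDyer.Theorems.GenusKolyvaginAtTwoGenusPrimitiveSupplyAtTwoLocalTwoTorsion
import Summits.BirchSwinnertonDyer.BirchSwinnertonDyer.Theorems.TwoAdicConverseFrobeniusParityTwoDivisionRoot
import Literature.NumberTheory.EllipticCurves.LocalPointsPlaceTransportProofs
import Literature.NumberTheory.NumberFields.AdicCompletionSquareCriteria
import HarnessLib

/-!
# Route ByReductionTypeAtTwo, crux `RankOneAtTwoBigImageOddLocal` (stmt-BirchSwinnertonDyer-23715), LINE v8.10 `one_door_analytic`: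
# THE FIRST-LAYER CLASSES AT `Δ_W < 0` FROM ITEM 24880 — `FirstLayerClassesAtTwoBottomNeg ⟸ KolyvaginRelationAtTwo`

Lead prover seat `bsd-line-fkl-p1` g13 (2026-08-28), `--supports stmt-BirchSwinnertonDyer-23715` (helper).  THEOREMS ONLY; no definition,
no named fact introduced, no `sorry`; BSD is not proved by any of this.

The registered stub `stub_firstLayerClassesNeg : FirstLayerClassesAtTwoBottomNeg` of skeleton v8.10 (the six first-layer fields `c₁, c₂,
c₁_loc, c₂_loc, c₁_loc_iff, c₂_loc_iff` of Kolyvagin's first `2`-descent over `ℚ` at a minimal `Δ_W < 0` door) is DERIVED here from route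
GenusKolyvaginAtTwo's item 24880 `KolyvaginRelationAtTwo` BY NAME (itself a tree theorem modulo the ONE print fact Gross 1991 Prop. 3.7 (2) =
Nekovář 2007 Prop. 4.9, `GenusExact.kolyvaginRelationAtTwo_of_frobeniusCongruence`), by kernel glue over tree theorems only:

* classes: `c₁ ℓ`, `c₂ ℓ` = the two descents to `ℚ` (on `W` and on the twin model `Wd`) of Kolyvagin's class `c(ℓ) ∈ H¹(K, E[2])` of a
  conductor-`ℓ` Kolyvagin–Heegner datum compatible with a conductor-`1` datum over the frame `(Dt, H.β, ι)` of the door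
  (`…OneDoorBottomFirstLayerData`: Gross's CM data, Shimura reciprocity at conductor `1`, Gross 5.4 at `2`, the `±` descents);
* `c₁_loc` / `c₂_loc` (Gross 6.2 (1) over `ℚ` off `{ℓ, q₀}`): Lemma 4.3 OVER `K` at every `w ∤ ℓ` — at `p = 2` on the odd-Tamagawa slice a
  THEOREM with no Heegner-divisor input (`…OneDoorBottomLemma43AtTwo`: Milne I.3.8 + `c_w(E/K)` odd) — descended to `ℚ` place by place by
  route GenusKolyvaginAtTwo's one-place transfers (`VisiblePairAtTwo.mem_selmerLocalKer_of_K_of_heegner` / `…_twin_…`: split, ramified with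
  `E(ℚ_v)[2] = 0`, inert-good), the ramified condition `#E(ℚ_v)[2] = 1` at every `v ∣ d_K`, `v ≠ v_{q₀}` being the MINIMALITY of the door
  (`t = 1`, `s = 0`: every other prime of `d_K` is a `3`-cycle prime, `a_v` odd — `natCard_twoTorsion_eq_one_of_minimal`); the real place is
  free at `Δ < 0` (`mem_selmerLocalKer_infinitePlace_of_Δ_neg`);
* `c₁_loc_iff` / `c₂_loc_iff` (Gross 6.2 (2) over `ℚ`, direct and across): item 24880 at `(M, m, l) = (1, 1, ℓ)`, `j = 0`, the bottom class
  `c(1) = κ_K(P) = res y`, and the `ℚ ⟷ K` dictionaries at the inert good prime `ℓ` (`SelmerDescent.zsmul_mem_selmerLocalKer_iff_resTorsion`,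
  `…zsmul_mem_torsionLocalKer_iff_resTorsion_of_notMem`, `…zsmul_twist_mem_selmerLocalKer_iff_zsmul_mem_torsionLocalKer_of_K`);
* bookkeeping: the classes live at level `((2 ^ 1 : ℕ) : ℤ)` and are read at the record's level `2` by `exists_levelTransport`; the twin
  `W^{(d_K)}` is read on the model `Wd` along `Cd • W^{(d_K)} = Wd` (`locAt_iff_h1TorsionIso`, `strictAt_iff_h1TorsionIso`).

Main theorems: `exists_firstLayerClass_at` (one Kolyvagin prime, level `2^1`), `firstLayerClassesAtTwoBottomNeg_of_kolyvaginRelationAtTwo`.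
With `…OneDoorBottomAssemblyNegFull` (`firstDescentLeavesAtTwoBottomNeg_of_classes`) and the frame (`doorIndexLawUpperCAtTwoBottom_of_leaves`),
the corner U₀⁻ of 23715 becomes: PRINT (Gross–Zagier, Kolyvagin, modularity, Hoffstein–Luo, Cassels–Tate, Gross 3.7 (2)) + kernel glue.

References: [GrossLMS1991] §§3–6 (Props. 3.6, 3.7, 5.4, 6.1, 6.2), §4 (4.1), (4.4); [McCallumLMS1991] §4 Lemma 4.3, Prop. 4.4, §5;
[Kolyvagin1989Izv] §3; [MazurRubin2010] Lemma 2.2 (i); [Kramer1981] Prop. 3; [MilneADT2006] I Prop. 3.8; [WZhang2014] Notations (xii).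
-/

set_option autoImplicit false
-- the Theorems namespace of this sub repeats the summit name by design (D-0017 nested layout)
set_option linter.dupNamespace false

noncomputable section

open scoped Classical

namespace Summit.BirchSwinnertonDyer.BirchSwinnertonDyer.Theorems.RankOneAtTwoOneDoor

open WeierstrassCurve NumberField IsDedekindDomain Field Rat.HeightOneSpectrum
  Literature.NumberTheory.EllipticCurves Literature.NumberTheory.EllipticCurves.ModularForms
  Literature.NumberTheory.GaloisRepresentations
  Summit.BirchSwinnertonDyer.Rank1Residual.F1Sign2
  Summit.BirchSwinnertonDyer.Rank1Residual.F1Sign2.TranspositionDoor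
  Summit.BirchSwinnertonDyer.BirchSwinnertonDyer.Theorems.GenusExact
  Summit.BirchSwinnertonDyer.BirchSwinnertonDyer.Theorems.GenusExact.VisiblePairAtTwo
  Summit.BirchSwinnertonDyer.BirchSwinnertonDyer.Theorems.GenusExact.SelmerDescent
  Summit.BirchSwinnertonDyer.BirchSwinnertonDyer.Theorems.GenusExact.TwinGrossPrimes
  Summit.BirchSwinnertonDyer.BirchSwinnertonDyer.Theorems.GenusExact.EigenClassesFinite

/-! ### §1 The minimal door: `#E(ℚ_v)[2] = 1` at every prime `v ∣ d_K` other than the transposition prime -/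

/-- **At a minimal `Δ_W < 0` door every prime of `d_K` other than the transposition prime `q₀` is a `3`-cycle prime**: for `d` door-admissible
with `t(W, d) = 1`, `s(W, d) = 0`, `q₀ ∣ d` with `(Δ_min/q₀) = −1`, and a place `v ∋ d`, `v ≠ v_{q₀}`: `#E(ℚ_v)[2] = 1`.  (The prime `q` of `v` is
good, odd, `q ∤ Δ_min`; `(Δ_min/q) ≠ −1` as `t = 1`, so `= +1`, and `a_q` is odd as `s = 0`; then the `2`-division cubic has no root mod `q`
(`TwoAdicTwistConverse.odd_frobeniusTrace_iff_forall_ne_zero`), so `E(ℚ_q)[2] = 0` by Hensel (`GenusKolyTwin.twoTorsion_padic_eq_zero_of_forall_ne`),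
read at the place `v` (`natCard_ker_nsmul_adicCompletion_eq_one_of_forall_padic`).) [cite: Kramer1981, Prop. 3] [cite: MazurRubin2010, Lemma 2.2 (i)]
[cite: SilvermanAEC2009, III.2.3, V.2.3.1, VII.3.1] -/
theorem natCard_twoTorsion_eq_one_of_minimal (W : WeierstrassCurve ℚ) [W.IsElliptic] [W.IsGloballyMinimal] {d : ℤ}
    (hadm : DoorAdmissible W d) (ht : transpCount W d = 1) (hs : identCount W d = 0)
    {q₀ : ℕ} (hq₀ : q₀.Prime) (hq₀d : (q₀ : ℤ) ∣ d) (hjac : jacobiSym W.Δ.num q₀ = -1)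
    {v : HeightOneSpectrum (𝓞 ℚ)} (hv₀ : v ≠ primesEquiv.symm ⟨q₀, hq₀⟩) (hdv : ((d : ℤ) : 𝓞 ℚ) ∈ v.asIdeal) :
    Nat.card (nsmulAddMonoidHom 2 : (W.baseChange (v.adicCompletion ℚ)).toAffine.Point →+ _).ker = 1 := by
  obtain ⟨hdneg, hsqf, hd8, hgoodd, -⟩ := hadm
  -- the prime `q` of `v`
  set q : ℕ := (primesEquiv v : ℕ) with hqdef
  have hq : q.Prime := (primesEquiv v).2
  haveI : Fact q.Prime := ⟨hq⟩
  have hqv : (q : 𝓞 ℚ) ∈ v.asIdeal := natCast_primesEquiv_mem_asIdeal v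
  have hvq : v = primesEquiv.symm ⟨q, hq⟩ := by rw [Equiv.eq_symm_apply]; exact Subtype.ext rfl
  have hqd : (q : ℤ) ∣ d := (Literature.NumberTheory.NumberFields.intCast_mem_asIdeal_iff_of_natCast_mem hq v hqv d).mp hdv
  have hqq₀ : q ≠ q₀ := by
    intro h
    apply hv₀
    rw [hvq]
    exact congrArg _ (Subtype.ext h)
  have hq2 : q ≠ 2 := by
    intro h2
    rw [h2] at hqd
    have h2d : (2 : ℤ) ∣ d := by exact_mod_cast hqd
    omega
  have hgood : W.HasGoodReductionAtPrime q := hgoodd q hq hqd ⟨hq⟩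
  have hqΔmin : ¬ (q : ℤ) ∣ minimalDiscriminantInt W := not_dvd_minimalDiscriminantInt_of_hasGoodReductionAtPrime' W q hgood
  have hnum : W.Δ.num = minimalDiscriminantInt W := by rw [← cast_minimalDiscriminantInt W, Rat.num_intCast]
  have hqΔ : ¬ (q : ℤ) ∣ W.Δ.num := by rw [hnum]; exact hqΔmin
  -- `q ∈ primeFactors |d|`
  have hqpf : q ∈ d.natAbs.primeFactors :=
    Nat.mem_primeFactors.mpr ⟨hq, Int.ofNat_dvd_left.mp hqd, Int.natAbs_ne_zero.mpr hdneg.ne⟩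
  have hq₀pf : q₀ ∈ d.natAbs.primeFactors :=
    Nat.mem_primeFactors.mpr ⟨hq₀, Int.ofNat_dvd_left.mp hq₀d, Int.natAbs_ne_zero.mpr hdneg.ne⟩
  -- `(Δ/q) ≠ −1` (else two transposition primes)
  have hjq : jacobiSym W.Δ.num q ≠ -1 := by
    intro hj
    unfold transpCount at ht
    obtain ⟨a, ha⟩ := Finset.card_eq_one.mp ht
    have h1 : q ∈ ({a} : Finset ℕ) := by rw [← ha]; exact Finset.mem_filter.mpr ⟨hqpf, hj⟩
    have h2 : q₀ ∈ ({a} : Finset ℕ) := by rw [← ha]; exact Finset.mem_filter.mpr ⟨hq₀pf, hjac⟩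
    rw [Finset.mem_singleton] at h1 h2
    exact hqq₀ (h1.trans h2.symm)
  -- `(Δ/q) = 1`
  have hgcd : Int.gcd W.Δ.num q = 1 := by
    have hcop : Nat.Coprime q W.Δ.num.natAbs :=
      (Nat.Prime.coprime_iff_not_dvd hq).mpr fun h => hqΔ (Int.ofNat_dvd_left.mpr h)
    change W.Δ.num.natAbs.gcd (q : ℤ).natAbs = 1
    rw [Int.natAbs_natCast]
    exact hcop.symm
  have hj1 : jacobiSym W.Δ.num q = 1 := by
    rcases jacobiSym.trichotomy W.Δ.num q with h0 | h1 | hm1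
    · exact absurd hgcd (jacobiSym.eq_zero_iff.mp h0).2
    · exact h1
    · exact absurd hm1 hjq
  -- `a_q` odd (else an identity prime)
  have hodd : Odd (W.frobeniusTrace q) := by
    rw [← Int.not_even_iff_odd]
    intro heven
    unfold identCount at hs
    have hmem : q ∈ d.natAbs.primeFactors.filter fun q => jacobiSym W.Δ.num q = 1 ∧ Even (W.frobeniusTrace q) :=
      Finset.mem_filter.mpr ⟨hqpf, hj1, heven⟩
    rw [Finset.card_eq_zero] at hs
    rw [hs] at hmem
    exact Finset.notMem_empty q hmem
  -- no root of the `2`-division cubic mod `q`, hence `E(ℚ_q)[2] = 0`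
  have hnoroot := (TwoAdicTwistConverse.odd_frobeniusTrace_iff_forall_ne_zero W q hq2 hgood).mp hodd
  have hzero := GenusKolyTwin.twoTorsion_padic_eq_zero_of_forall_ne W hq2 hqΔmin hnoroot
  exact W.natCard_ker_nsmul_adicCompletion_eq_one_of_forall_padic hqv (n := 2) hzero

/-! ### §2 One Kolyvagin prime: the two descended classes and their four leaves (level `2^1`) -/

/-- **The first-layer classes at ONE Kolyvagin prime `ℓ`, level `((2 ^ 1 : ℕ) : ℤ)`.**  Setting: `W/ℚ` globally minimal, non-CM, `ρ_{W,2^k}` onto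
for all `k`, `∏ c_v(W)` odd, `Δ_W < 0`; `K = ℚ(θ)` imaginary quadratic, `θ² = d_K` odd `< −4`, Heegner hypothesis for `N_W`; a door datum `(Dt, H, ι, P)`
with `P ↦ heegnerPointComplex Dt H`; a finite place `v₀` such that `#E(ℚ_v)[2] = 1` at every other `v ∣ d_K`; a class `yL ∈ H¹(ℚ, W[2^1])` with
`res yL = κ_K(P)`; and route GenusKolyvaginAtTwo's item 24880 `KolyvaginRelationAtTwo` (`hrel`).  For every `ℓ` with `KolNeg W K ℓ` there are
`u ∈ H¹(ℚ, W[2^1])` and `u' ∈ H¹(ℚ, W^{(d_K)}[2^1])` — the descents of Kolyvagin's `c(ℓ)` — such that: `u` (resp. `u'`) is Selmer at every finite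
`v ∌ ℓ`, `v ≠ v₀` and at the real place; and at the place of `ℓ`, `u` Selmer ⟺ `yL` strict ⟺ `u'` Selmer (Gross 6.2 (2) direct and across).
[cite: GrossLMS1991, Props. 3.7, 5.4, 6.1, 6.2] [cite: McCallumLMS1991, Lemma 4.3, Prop. 4.4] [cite: Kolyvagin1989Izv, §3] -/
theorem exists_firstLayerClass_at
    (hrel : Summit.BirchSwinnertonDyer.BirchSwinnertonDyer.Theses.GenusKolyvaginAtTwo.KolyvaginRelationAtTwo)
    (W : WeierstrassCurve ℚ) [W.IsElliptic] [W.IsGloballyMinimal] [NeZero (W.conductorNorm ℤ)] (hCM : ¬ W.HasCM)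
    (hsurj : ∀ k : ℕ, W.HasSurjectiveModNGaloisRep ((2 ^ k : ℕ) : ℤ)) (hc : Odd W.tamagawaProduct) (hΔ : W.Δ < 0)
    (K : Type) [Field K] [NumberField K] (hK : IsImaginaryQuadratic K) (hdodd : Odd (NumberField.discr K))
    (hD : NumberField.discr K < -4) (hH : SatisfiesHeegnerHypothesis (W.conductorNorm ℤ) K)
    {θ : K} (hθ : θ ∉ Set.range (algebraMap ℚ K)) (hθsq : θ ^ 2 = algebraMap ℚ K ((NumberField.discr K : ℤ) : ℚ))
    (Dt : ModularParametrizationData W (W.conductorNorm ℤ)) (H : HeegnerDatum (W.conductorNorm ℤ) (NumberField.discr K)) (ι : K →+* ℂ)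
    (P : (W.baseChange K).toAffine.Point) (hP : WeierstrassCurve.Affine.Point.map ι.toRatAlgHom P = heegnerPointComplex Dt H)
    (v₀ : HeightOneSpectrum (𝓞 ℚ))
    (htors : ∀ v : HeightOneSpectrum (𝓞 ℚ), v ≠ v₀ → ((NumberField.discr K : ℤ) : 𝓞 ℚ) ∈ v.asIdeal →
      Nat.card (nsmulAddMonoidHom 2 : (W.baseChange (v.adicCompletion ℚ)).toAffine.Point →+ _).ker = 1)
    (yL : galH1Torsion W ((2 ^ 1 : ℕ) : ℤ))
    (hdL : ∀ Q : geomPoints (W.baseChange K), ∃ R : geomPoints (W.baseChange K), ((2 ^ 1 : ℕ) : ℤ) • R = Q)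
    (hyL : resTorsion W K ((2 ^ 1 : ℕ) : ℤ) yL = kummerMapTorsion (W.baseChange K) ((2 ^ 1 : ℕ) : ℤ) hdL P)
    {ℓ : ℕ} (hKol : KolNeg W K ℓ) :
    ∃ (u : galH1Torsion W ((2 ^ 1 : ℕ) : ℤ)) (u' : galH1Torsion (W.quadraticTwist ((NumberField.discr K : ℤ) : ℚ)) ((2 ^ 1 : ℕ) : ℤ)),
      (∀ v : HeightOneSpectrum (𝓞 ℚ), (ℓ : 𝓞 ℚ) ∉ v.asIdeal → v ≠ v₀ → u ∈ selmerLocalKer W (v.adicCompletion ℚ) ((2 ^ 1 : ℕ) : ℤ)) ∧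
      (∀ w : InfinitePlace ℚ, u ∈ selmerLocalKer W w.Completion ((2 ^ 1 : ℕ) : ℤ)) ∧
      (∀ v : HeightOneSpectrum (𝓞 ℚ), (ℓ : 𝓞 ℚ) ∈ v.asIdeal →
        (u ∈ selmerLocalKer W (v.adicCompletion ℚ) ((2 ^ 1 : ℕ) : ℤ) ↔ yL ∈ W.torsionLocalKer (v.adicCompletion ℚ) ((2 ^ 1 : ℕ) : ℤ))) ∧
      (∀ v : HeightOneSpectrum (𝓞 ℚ), (ℓ : 𝓞 ℚ) ∉ v.asIdeal → v ≠ v₀ →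
        u' ∈ selmerLocalKer (W.quadraticTwist ((NumberField.discr K : ℤ) : ℚ)) (v.adicCompletion ℚ) ((2 ^ 1 : ℕ) : ℤ)) ∧
      (∀ w : InfinitePlace ℚ, u' ∈ selmerLocalKer (W.quadraticTwist ((NumberField.discr K : ℤ) : ℚ)) w.Completion ((2 ^ 1 : ℕ) : ℤ)) ∧
      (∀ v : HeightOneSpectrum (𝓞 ℚ), (ℓ : 𝓞 ℚ) ∈ v.asIdeal →
        (u' ∈ selmerLocalKer (W.quadraticTwist ((NumberField.discr K : ℤ) : ℚ)) (v.adicCompletion ℚ) ((2 ^ 1 : ℕ) : ℤ) ↔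
          yL ∈ W.torsionLocalKer (v.adicCompletion ℚ) ((2 ^ 1 : ℕ) : ℤ))) := by
  have h2K : Module.finrank ℚ K = 2 := hK.1
  have hD3 : NumberField.discr K ≠ -3 := by omega
  have hD4 : NumberField.discr K ≠ -4 := by omega
  have hd0 : ((NumberField.discr K : ℤ) : ℚ) ≠ 0 := by exact_mod_cast NumberField.discr_ne_zero K
  haveI : (W.baseChange K).IsElliptic := by rw [baseChange]; infer_instance
  haveI htwE : (W.quadraticTwist ((NumberField.discr K : ℤ) : ℚ)).IsElliptic := isElliptic_quadraticTwist W hd0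
  have hsurj1 : W.HasSurjectiveModNGaloisRep ((2 : ℤ) ^ 1) := by simpa using hsurj 1
  have hθ' : θ ∉ (algebraMap ℚ K).range := not_mem_range hθ
  -- the Kolyvagin prime
  obtain ⟨hFrob, hZK, hidx⟩ := hKol
  have hℓ : ℓ.Prime := hZK.1
  haveI : Fact ℓ.Prime := ⟨hℓ⟩
  have hℓN : ¬ ℓ ∣ W.conductorNorm ℤ := hZK.2.1
  have hℓd : ¬ ((ℓ : ℤ) ∣ NumberField.discr K) := hZK.2.2.1
  have hℓ2 : ℓ ≠ 2 := hZK.2.2.2.1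
  have hprime : (Ideal.span {(ℓ : 𝓞 K)}).IsPrime := hZK.2.2.2.2.1
  have hgood : W.HasGoodReductionAtPrime ℓ := hasGoodReductionAtPrime_of_not_dvd_conductorNorm W hℓN
  have hgood' : (W.quadraticTwist ((NumberField.discr K : ℤ) : ℚ)).HasGoodReductionAtPrime ℓ :=
    hasGoodReductionAtPrime_of_smul_quadraticTwist_eq W h2K hdodd (W.quadraticTwist ((NumberField.discr K : ℤ) : ℚ)) (one_smul _ _)
      hℓd hgood
  have hΔ' : (W.quadraticTwist ((NumberField.discr K : ℤ) : ℚ)).Δ < 0 :=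
    Δ_neg_of_smul_quadraticTwist_eq W hd0 (W.quadraticTwist ((NumberField.discr K : ℤ) : ℚ)) (one_smul _ _) hΔ
  have hFrob1 : FrobEqFrobInfty W K (2 ^ 1) ℓ := by rwa [pow_one]
  have hsqℓ : Squarefree (1 * ℓ) := by rw [one_mul]; exact hℓ.prime.squarefree
  have hSℓ : ∀ q ∈ (1 * ℓ).primeFactors, Zhang2014.IsKolyvaginPrime (W.conductorNorm ℤ) W K 2 q ∧
      1 ≤ Zhang2014.kolyvaginIndex W 2 q := fun q hq ↦ by
    rw [one_mul, hℓ.primeFactors, Finset.mem_singleton] at hq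
    subst hq
    exact ⟨hZK, hidx⟩
  -- the compatible pair of data and the classes
  obtain ⟨d₁, dℓ, hσ, hS₁, hS₂, hemb⟩ := exists_kolyvaginHeegnerData_pair W K hK hD hH Dt H.β H.dvd_sq_sub ι hZK
  set cK := dℓ.kolyvaginClass Nat.prime_two 1 with hcK
  set c1K := d₁.kolyvaginClass Nat.prime_two 1 with hc1K
  -- the bottom class is `res yL`
  have hc1y : c1K = resTorsion W K ((2 ^ 1 : ℕ) : ℤ) yL := by
    rw [hc1K, kolyvaginClass_one_eq_kummerMapTorsion_of_heegnerPoint W K hK hdodd hH hsurj1 1 Dt H ι d₁ P hP, hyL]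
  -- the descents
  obtain ⟨⟨u, hu⟩, ⟨u', hu'⟩⟩ := exists_descents_kolyvaginClass_two W K hK hD3 hD4 hdodd hH hsurj1 hθ hθsq Dt H.β ι hsqℓ hSℓ dℓ
  -- Lemma 4.3 over `K` at every `w ∤ ℓ`
  have hK43 : ∀ w : HeightOneSpectrum (𝓞 K), ((1 * ℓ : ℕ) : 𝓞 K) ∉ w.asIdeal →
      cK ∈ selmerLocalKer (W.baseChange K) (w.adicCompletion K) ((2 ^ 1 : ℕ) : ℤ) := fun w hw ↦
    kolyvaginClass_two_mem_selmerLocalKer_of_odd_tamagawaProduct W hsurj hc K hK hD3 hD4 hH Dt H.β ι 1 hsqℓ hSℓ dℓ w hw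
  have hK43' : ∀ (v : HeightOneSpectrum (𝓞 ℚ)), (ℓ : 𝓞 ℚ) ∉ v.asIdeal → ∀ (w : HeightOneSpectrum (𝓞 K)) [w.asIdeal.LiesOver v.asIdeal],
      cK ∈ selmerLocalKer (W.baseChange K) (w.adicCompletion K) ((2 ^ 1 : ℕ) : ℤ) := by
    intro v hv w _
    refine hK43 w fun hw ↦ ?_
    have hℓw : ((ℓ : ℤ) : 𝓞 K) ∈ w.asIdeal := by rw [one_mul] at hw; exact_mod_cast hw
    have h := intCast_notMem_of_liesOver K v w (n := (ℓ : ℤ)) (by exact_mod_cast hv)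
    exact h hℓw
  -- the relation at the place(s) of `ℓ`
  have hrelw : ∀ w : HeightOneSpectrum (𝓞 K), (ℓ : 𝓞 K) ∈ w.asIdeal →
      (cK ∈ selmerLocalKer (W.baseChange K) (w.adicCompletion K) ((2 ^ 1 : ℕ) : ℤ) ↔
          cK ∈ (W.baseChange K).torsionLocalKer (w.adicCompletion K) ((2 ^ 1 : ℕ) : ℤ)) ∧
        (cK ∈ (W.baseChange K).torsionLocalKer (w.adicCompletion K) ((2 ^ 1 : ℕ) : ℤ) ↔
          c1K ∈ (W.baseChange K).torsionLocalKer (w.adicCompletion K) ((2 ^ 1 : ℕ) : ℤ)) := fun w hw ↦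
    kolyvaginRelation_at_prime_of_item hrel W hCM K hK hD3 hD4 hH hsurj Dt H.β ι hZK hidx d₁ dℓ hσ hS₁ hS₂ hemb w hw
  -- local data at the place of `ℓ`
  have hloc : ∀ v : HeightOneSpectrum (𝓞 ℚ), (ℓ : 𝓞 ℚ) ∈ v.asIdeal →
      W.HasGoodReductionAt v ∧ (W.quadraticTwist ((NumberField.discr K : ℤ) : ℚ)).HasGoodReductionAt v ∧
        (2 : 𝓞 ℚ) ∉ v.asIdeal ∧ ((((2 ^ 1 : ℕ) : ℤ)) : 𝓞 ℚ) ∉ v.asIdeal ∧ ((NumberField.discr K : ℤ) : 𝓞 ℚ) ∉ v.asIdeal := by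
    intro v hv
    obtain ⟨h2v, hqv⟩ := two_notMem_and_natCast_two_pow_notMem (rfl : 2 ^ 1 = 2 ^ 1) hℓ hℓ2 hv
    exact ⟨hasGoodReductionAt_of_hasGoodReductionAtPrime W hgood hv,
      hasGoodReductionAt_of_hasGoodReductionAtPrime _ hgood' hv, h2v, hqv, intCast_notMem_of_not_dvd hℓ hv hℓd⟩
  refine ⟨u, u', ?_, ?_, ?_, ?_, ?_, ?_⟩
  · -- `u` Selmer at finite `v ∌ ℓ`, `v ≠ v₀`
    intro v hv hv₀
    exact mem_selmerLocalKer_of_K_of_heegner W h2K hθ' hθsq hdodd hH ((2 ^ 1 : ℕ) : ℤ) hu v (htors v hv₀) (hK43' v hv)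
  · -- `u` at the real place
    intro w
    exact ArchVanishing.mem_selmerLocalKer_infinitePlace_of_Δ_neg W w hΔ _ u
  · -- `u` at the place of `ℓ`
    intro v hv
    obtain ⟨hgoodv, -, h2v, hqv, hdv⟩ := hloc v hv
    obtain ⟨w, hw⟩ := exists_natCast_mem (K := K) hℓ
    haveI := liesOver_of_natCast_mem hℓ hv hw
    have hf : w.asIdeal.inertiaDeg (𝓞 ℚ) = 2 := inertiaDeg_eq_two_of_span_isPrime h2K hℓ hprime hv hw
    have step1 := zsmul_mem_selmerLocalKer_iff_resTorsion W h2K hθ' hθsq ((2 ^ 1 : ℕ) : ℤ) v w hgoodv hqv h2v hdv u 1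
    have step3 := zsmul_mem_torsionLocalKer_iff_resTorsion_of_notMem W hΔ (M := 1) le_rfl (q := 2 ^ 1) rfl hℓ hℓ2 hv hgoodv h2K hθ'
      hθsq hdv hFrob1 w hf yL 1
    rw [one_zsmul, one_zsmul] at step1 step3
    rw [step1, hu, (hrelw w hw).1, (hrelw w hw).2, hc1y, ← step3]
  · -- `u'` Selmer at finite `v ∌ ℓ`, `v ≠ v₀`
    intro v hv hv₀
    exact mem_selmerLocalKer_twin_of_K_of_heegner W h2K hθ hθsq hdodd hH ((2 ^ 1 : ℕ) : ℤ) hu' v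
      (fun hdv ↦ (natCard_ker_two_twin_adicCompletion_eq W v).trans (htors v hv₀ hdv)) (hK43' v hv)
  · -- `u'` at the real place
    intro w
    exact ArchVanishing.mem_selmerLocalKer_infinitePlace_of_Δ_neg _ w hΔ' _ u'
  · -- `u'` at the place of `ℓ` (the CROSS relation)
    intro v hv
    obtain ⟨hgoodv, hgood'v, h2v, hqv, hdv⟩ := hloc v hv
    obtain ⟨w, hw⟩ := exists_natCast_mem (K := K) hℓ
    haveI := liesOver_of_natCast_mem hℓ hv hw
    have hf : w.asIdeal.inertiaDeg (𝓞 ℚ) = 2 := inertiaDeg_eq_two_of_span_isPrime h2K hℓ hprime hv hw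
    have hRel : (1 : ℤ) • cK ∈ selmerLocalKer (W.baseChange K) (w.adicCompletion K) ((2 ^ 1 : ℕ) : ℤ) ↔
        (1 : ℤ) • c1K ∈ (W.baseChange K).torsionLocalKer (w.adicCompletion K) ((2 ^ 1 : ℕ) : ℤ) := by
      rw [one_zsmul, one_zsmul]
      exact (hrelw w hw).1.trans (hrelw w hw).2
    have h := zsmul_twist_mem_selmerLocalKer_iff_zsmul_mem_torsionLocalKer_of_K W hΔ (M := 1) le_rfl (q := 2 ^ 1) rfl hℓ hℓ2 hv
      hgoodv h2K hθ' hθsq hdv hFrob1 w hf hθ hθsq hgood'v hc1y.symm hu' 1 hRel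
    rwa [one_zsmul, one_zsmul] at h

/-! ### §3 `FirstLayerClassesAtTwoBottomNeg ⟸ KolyvaginRelationAtTwo` -/

/-- **THE FIRST-LAYER CLASSES AT `Δ_W < 0` FROM ITEM 24880.**  `FirstLayerClassesAtTwoBottomNeg` (the registered stub `stub_firstLayerClassesNeg` of
skeleton v8.10 of crux 23715) follows from route GenusKolyvaginAtTwo's `KolyvaginRelationAtTwo` (item 24880) by kernel glue: §2 at every Kolyvagin
prime (habitat from door-admissibility: `d_K` odd `≡ 1 (8)`, `< −4`, Heegner hypothesis; `#E(ℚ_v)[2] = 1` off `q₀` from minimality, §1), then the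
classes are read at level `2` (`exists_levelTransport`) and the twin's on the model `Wd` (`locAt_iff_h1TorsionIso`, `strictAt_iff_h1TorsionIso`).
[cite: GrossLMS1991, §§3–6, §10] [cite: McCallumLMS1991, Lemma 4.3, Prop. 4.4] [cite: Kolyvagin1989Izv, §3] -/
theorem firstLayerClassesAtTwoBottomNeg_of_kolyvaginRelationAtTwo
    (hrel : Summit.BirchSwinnertonDyer.BirchSwinnertonDyer.Theses.GenusKolyvaginAtTwo.KolyvaginRelationAtTwo) :
    FirstLayerClassesAtTwoBottomNeg := by
  intro W _ _ _ hCM hsurj _hT hc _hr K _ _ hK hadm _hLt Dt H ι P hP Wd _ _ Cd hWd hmin _hodd _hm hΔ q₀ hq₀ hq₀d hjac hdivK y _hymem hyres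
  have h2K : Module.finrank ℚ K = 2 := hK.1
  haveI : (W.baseChange K).IsElliptic := by rw [baseChange]; infer_instance
  -- habitat bookkeeping
  obtain ⟨hdodd, -, -, -⟩ := kolyvaginAdmissible_of_doorAdmissible W hadm
  have hD : NumberField.discr K < -4 := by
    have h1 := hadm.1; have h8 := hadm.2.2.1; omega
  have hH : SatisfiesHeegnerHypothesis (W.conductorNorm ℤ) K := satisfiesHeegnerHypothesis_of_doorAdmissible W K hK hadm
  obtain ⟨θ, hθ, hθsq⟩ := Literature.NumberTheory.EllipticCurves.exists_sq_eq_discr_not_mem_range K h2K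
  obtain ⟨ht, hs⟩ := (minimal_iff_of_neg W _ hΔ).mp hmin
  set v₀ : HeightOneSpectrum (𝓞 ℚ) := primesEquiv.symm ⟨q₀, hq₀⟩ with hv₀
  have htors : ∀ v : HeightOneSpectrum (𝓞 ℚ), v ≠ v₀ → ((NumberField.discr K : ℤ) : 𝓞 ℚ) ∈ v.asIdeal →
      Nat.card (nsmulAddMonoidHom 2 : (W.baseChange (v.adicCompletion ℚ)).toAffine.Point →+ _).ker = 1 :=
    fun v hv hdv ↦ natCard_twoTorsion_eq_one_of_minimal W hadm ht hs hq₀ hq₀d hjac hv hdv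
  -- the class `y` read at level `2^1`
  have hdL : ∀ Q : geomPoints (W.baseChange K), ∃ R : geomPoints (W.baseChange K), ((2 ^ 1 : ℕ) : ℤ) • R = Q :=
    fun Q => (W.baseChange K).zsmul_geomPoints_surjective_of_charZero (by norm_num) Q
  obtain ⟨yL, hyloc, hystrict, hykum⟩ := exists_levelTransport W level_two_pow_one.symm y
  have hyL : resTorsion W K ((2 ^ 1 : ℕ) : ℤ) yL = kummerMapTorsion (W.baseChange K) ((2 ^ 1 : ℕ) : ℤ) hdL P :=
    (hykum K hdivK hdL P).mp hyres
  -- one Kolyvagin prime at a time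
  have key : ∀ ℓ : ℕ, ∃ (a : galH1Torsion W 2) (b : galH1Torsion Wd 2), KolNeg W K ℓ →
      (∀ v : RatPlace, v ≠ plOfNat ℓ → v ≠ Sum.inl v₀ → a ∈ locAt W 2 v) ∧
      (a ∈ locAt W 2 (plOfNat ℓ) ↔ y ∈ strictAt W 2 (plOfNat ℓ)) ∧
      (∀ v : RatPlace, v ≠ plOfNat ℓ → v ≠ Sum.inl v₀ → b ∈ locAt Wd 2 v) ∧
      (b ∈ locAt Wd 2 (plOfNat ℓ) ↔ y ∈ strictAt W 2 (plOfNat ℓ)) := by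
    intro ℓ
    by_cases hKol : KolNeg W K ℓ
    · have hℓ : ℓ.Prime := hKol.2.1.1
      obtain ⟨u, u', hu₁, hu₂, hu₃, hu'₁, hu'₂, hu'₃⟩ := exists_firstLayerClass_at hrel W hCM hsurj hc hΔ K hK hdodd hD hH hθ hθsq Dt H ι
        P hP v₀ htors yL hdL hyL hKol
      -- read `u`, `u'` at level `2`, `u'` on the model `Wd`
      obtain ⟨a, haloc, hastrict, -⟩ := exists_levelTransport W level_two_pow_one u
      obtain ⟨b', hbloc, hbstrict, -⟩ := exists_levelTransport (W.quadraticTwist ((NumberField.discr K : ℤ) : ℚ)) level_two_pow_one u'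
      set vℓ : HeightOneSpectrum (𝓞 ℚ) := primesEquiv.symm ⟨ℓ, hℓ⟩ with hvℓ
      have hℓv : (ℓ : 𝓞 ℚ) ∈ vℓ.asIdeal := natCast_mem_primesEquiv_symm hℓ
      have hpl : plOfNat ℓ = Sum.inl vℓ := plOfNat_of_prime hℓ
      refine ⟨a, h1TorsionIso 2 hWd b', fun _ ↦ ⟨?_, ?_, ?_, ?_⟩⟩
      · rintro (v | w) hv hv₀
        · have hvℓ' : (ℓ : 𝓞 ℚ) ∉ v.asIdeal := fun h ↦ hv (by rw [hpl, (natCast_prime_mem_iff_eq hℓ v).mp h])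
          have h := hu₁ v hvℓ' (fun h ↦ hv₀ (by rw [h]))
          exact (haloc (Sum.inl v)).mp h
        · exact (haloc (Sum.inr w)).mp (hu₂ w)
      · rw [hpl]
        exact ((haloc (Sum.inl vℓ)).symm.trans (hu₃ vℓ hℓv)).trans (hystrict (Sum.inl vℓ)).symm
      · rintro (v | w) hv hv₀
        · have hvℓ' : (ℓ : 𝓞 ℚ) ∉ v.asIdeal := fun h ↦ hv (by rw [hpl, (natCast_prime_mem_iff_eq hℓ v).mp h])
          have h := hu'₁ v hvℓ' (fun h ↦ hv₀ (by rw [h]))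
          exact (locAt_iff_h1TorsionIso hWd 2 b' (Sum.inl v)).mp ((hbloc (Sum.inl v)).mp h)
        · exact (locAt_iff_h1TorsionIso hWd 2 b' (Sum.inr w)).mp ((hbloc (Sum.inr w)).mp (hu'₂ w))
      · rw [hpl, ← locAt_iff_h1TorsionIso hWd 2 b' (Sum.inl vℓ)]
        exact ((hbloc (Sum.inl vℓ)).symm.trans (hu'₃ vℓ hℓv)).trans (hystrict (Sum.inl vℓ)).symm
    · exact ⟨0, 0, fun h ↦ (hKol h).elim⟩
  choose c₁ c₂ hc using key
  exact ⟨⟨c₁, c₂, fun ℓ h ↦ (hc ℓ h).1, fun ℓ h ↦ (hc ℓ h).2.1, fun ℓ h ↦ (hc ℓ h).2.2.1, fun ℓ h ↦ (hc ℓ h).2.2.2⟩⟩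

end Summit.BirchSwinnertonDyer.BirchSwinnertonDyer.Theorems.RankOneAtTwoOneDoor

end
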